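import Mathlib
import Summits.AtomisticToContinuum.HydrodynamicLimit.Theorems.ImplosionDichotomyDenseExcursionPackingAnalyticMajorantAnalytic

/-!
# The weighted sup of the sources of the hierarchy of `Γ`: the pointwise majorant bound
# (crux `DenseExcursion`, stmt-AtomisticToContinuum-12586, line `sonic-cavity-renewal` v7, stub `stub_analyticPackingImplosion`)

Helper file (`--supports stmt-AtomisticToContinuum-12586`, line lead a2, wave-3 worker D, task `packingSources_regular`,
quantitative half). The order-`k` sources `Src_k = (Src_w, Src_s)` of `packingHierarchy_order` (stiffening coefficients in
the closed form of `familyCoeff_stiffening`, jet `m_j`) are estimated AT A POINT `x` in the weights of `PackingResolvent`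
(`1` on the `w`-component, `1/S` on the `s`-component) by a MAJORANT POLYNOMIAL in the numbers
`T_i ≥ |wc i| + |wc i′| + |sc i|/S + (1 + S²)|(sc i/S)′|` (`1 ≤ i < k`, all at `x`) — the pointwise densities of the norms
`‖X_i‖₀ + ‖X_i‖₁` of the W6 report §4 — with coefficients depending only on the profile quantities
`σ₁ ≥ |S′/S|`, `σ₂ ≥ |S(S′ + S)|`, `Φ ≥ e^{3x}S³` at `x` and on `|m_j|`:

* `packingSources_bound` (REGISTERED helper):
  `|Src_w| + |Src_s|/S ≤ (9 + 3σ₂ + σ₁)·[Gᵏ]T² + 3(1 + σ₂) Σ_{p<k} [Gᵖ](1+T)² · Σ_{j ≤ k−p} |m_j| Φʲ [G^{k−p−j}](1+T)^{3j}`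
  (`T = Σ_{i≥1} T_i Gⁱ`, `[Gⁿ] = PowerSeries.coeff n`). Mechanism: with `v_i = sc i/S` the pressure monomials are
  `sc i (sc j′ + sc j) = S² v_i v_j′ + S(S′+S) v_i v_j` (weight `S²` on `v′`, bounded factor `S(S′+S)`), the `s`-source
  over `S` is `wc i (v_j′ + (S′/S) v_j) + v_i wc j′/3 + 2 v_i wc j` (weight `1` on `v′`), and the stiffening coefficients
  are dominated through `e^{3jx}[·](Σ sc n Gⁿ)^{3j} = (e^{3x}S³)ʲ [·](Σ v_n Gⁿ)^{3j}` and `|v_n| ≤ [Gⁿ](1 + T)`;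
* tools: `abs_coeff_mk_pow_le` (`|[Gᵈ](Σ vₙGⁿ)ᴺ| ≤ [Gᵈ](Σ |vₙ|Gⁿ)ᴺ`), `coeff_mk_const_mul_pow` (homogeneity).

Pure real algebra over Mathlib's `PowerSeries` (+ `coeff_pow_mono` of `…MajorantAnalytic`). NOT here: the passage to the
one-variable recursion of `analytic_majorant_seeded` (shift `G ≤ T/T₁`), norms, or `Γ`.
-/

noncomputable section

open Finset PowerSeries

namespace Summit.AtomisticToContinuum.HydrodynamicLimit.Theorems.PackingAnalyticImplosion

/-! ## Power-series tools -/

/-- `|[Gᵈ](Σ vₙ Gⁿ)ᴺ| ≤ [Gᵈ](Σ |vₙ| Gⁿ)ᴺ`. [folklore] -/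
theorem abs_coeff_mk_pow_le (v : ℕ → ℝ) :
    ∀ N d : ℕ, |coeff d ((PowerSeries.mk v) ^ N)| ≤ coeff d ((PowerSeries.mk fun n => |v n|) ^ N) := by
  intro N
  induction N with
  | zero =>
    intro d
    simp only [pow_zero, coeff_one]
    split_ifs <;> simp
  | succ N ih =>
    intro d
    rw [pow_succ, pow_succ, coeff_mul, coeff_mul]
    refine (abs_sum_le_sum_abs _ _).trans (sum_le_sum fun p _ => ?_)
    rw [abs_mul, coeff_mk, coeff_mk]
    exact mul_le_mul_of_nonneg_right (ih p.1) (abs_nonneg _)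

/-- Homogeneity: `[Gᵈ](Σ S vₙ Gⁿ)ᴺ = Sᴺ [Gᵈ](Σ vₙ Gⁿ)ᴺ`. [folklore] -/
theorem coeff_mk_const_mul_pow (S : ℝ) (v : ℕ → ℝ) (N d : ℕ) :
    coeff d ((PowerSeries.mk fun n => S * v n) ^ N) = S ^ N * coeff d ((PowerSeries.mk v) ^ N) := by
  have e : (PowerSeries.mk fun n => S * v n) = PowerSeries.C S * PowerSeries.mk v := by
    ext n; simp [coeff_C_mul]
  rw [e, mul_pow, ← map_pow, coeff_C_mul]

/-- The series `1 + T` with `T₀ = 0` has coefficients `U₀ = 1`, `Uₙ = Tₙ`. [folklore] -/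
theorem one_add_mk_eq {T : ℕ → ℝ} (hT0 : T 0 = 0) :
    (1 + PowerSeries.mk T : PowerSeries ℝ) = PowerSeries.mk fun n => if n = 0 then 1 else T n := by
  ext n
  simp only [map_add, coeff_one, coeff_mk]
  split_ifs with h
  · simp [h, hT0]
  · simp

/-- `[Gᵖ] U² = Σ_{i ≤ p} U_i U_{p−i}`. [folklore] -/
theorem coeff_mk_sq (U : ℕ → ℝ) (p : ℕ) :
    coeff p ((PowerSeries.mk U) ^ 2) = ∑ i ∈ range (p + 1), U i * U (p - i) := by
  rw [sq, coeff_mul, Nat.sum_antidiagonal_eq_sum_range_succ (fun i j => coeff i (PowerSeries.mk U) *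
    coeff j (PowerSeries.mk U)) p]
  simp only [coeff_mk]

/-- The inner (pressure) sums are dominated by `[Gᵖ] U²`. [folklore] -/
theorem inner_sum_le {F : ℕ → ℕ → ℝ} {U : ℕ → ℝ} {L : ℝ} {p : ℕ}
    (h : ∀ i, i ≤ p → |F i (p - i)| ≤ L * U i * U (p - i)) :
    |∑ i ∈ range (p + 1), F i (p - i)| ≤ L * coeff p ((PowerSeries.mk U) ^ 2) := by
  rw [coeff_mk_sq, mul_sum]
  refine (abs_sum_le_sum_abs _ _).trans (sum_le_sum fun i hi => ?_)
  have := h i (Nat.lt_succ_iff.mp (mem_range.mp hi))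
  linarith [this]

/-! ## The pointwise bound -/

/-- **THE WEIGHTED SUP OF THE SOURCES, POINTWISE** (registered helper `packingSources_bound` of
`stub_analyticPackingImplosion`): at a point `x`, with `S = sc 0 > 0`, `σ₁ ≥ |S′/S|`, `σ₂ ≥ |S(S′+S)|`, `Φ ≥ e^{3x}S³`
and majorant numbers `T_i ≥ |wc i| + |wc i′| + |sc i|/S + (1 + S²)|(sc i/S)′|` for `1 ≤ i < k` (`T₀ = 0`, `T ≥ 0`),
the order-`k` sources of `packingHierarchy_order` (stiffening coefficients `Mc` in the closed form of
`familyCoeff_stiffening` with jet `m`) satisfy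
`|Src_w| + |Src_s|/S ≤ (9 + 3σ₂ + σ₁)[Gᵏ]T² + 3(1+σ₂) Σ_{p<k} [Gᵖ](1+T)² Σ_{j≤k−p} |m_j| Φʲ [G^{k−p−j}](1+T)^{3j}`.
[folklore] -/
theorem packingSources_bound : ∀ (wc sc : ℕ → ℝ → ℝ) (m : ℕ → ℝ) (Mc : ℕ → ℝ → ℝ) (Sw Ss : ℝ → ℝ) (T : ℕ → ℝ) (k : ℕ) (x σ₁ σ₂ Φ : ℝ), (∀ c, Mc c x = ∑ j ∈ Finset.range (c + 1), m j * Real.exp (3 * x) ^ j * PowerSeries.coeff (c - j) ((PowerSeries.mk fun n => sc n x) ^ (3 * j))) → (Sw x = (∑ i ∈ Finset.Ico 1 k, (wc i x * deriv (wc (k - i)) x + wc i x * wc (k - i) x + 3 * (sc i x * (deriv (sc (k - i)) x + sc (k - i) x)))) + 3 * ∑ p ∈ Finset.range k, (∑ i ∈ Finset.range (p + 1), sc i x * (deriv (sc (p - i)) x + sc (p - i) x)) * Mc (k - p) x) → (Ss x = ∑ i ∈ Finset.Ico 1 k, (wc i x * deriv (sc (k - i)) x + sc i x / 3 * deriv (wc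 (k - i)) x + 2 * (sc i x * wc (k - i) x))) → 0 < sc 0 x → (∀ i, i < k → DifferentiableAt ℝ (sc i) x) → |deriv (sc 0) x / sc 0 x| ≤ σ₁ → |sc 0 x * (deriv (sc 0) x + sc 0 x)| ≤ σ₂ → Real.exp (3 * x) * sc 0 x ^ 3 ≤ Φ → T 0 = 0 → (∀ i, 0 ≤ T i) → (∀ i, 1 ≤ i → i < k → |wc i x| + |deriv (wc i) x| + |sc i x| / sc 0 x + (1 + sc 0 x ^ 2) * |deriv (fun y => sc i y / sc 0 y) x| ≤ T i) → |Sw x| + |Ss x| / sc 0 x ≤ (9 + 3 * σ₂ + σ₁) * PowerSeries.coeff k (PowerSeries.mk T ^ 2) + 3 * (1 + σ₂) * ∑ p ∈ Finset.range k, PowerSeries.coeff p ((1 + PowerSeries.mk T) ^ 2) * ∑ j ∈ Finset.range (k - p + 1), |m j| * Φ ^ j * PowerSeries.coeff (k - p - j) ((1 + PowerSeries.mk T) ^ (3 * j)) := by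
  intro wc sc m Mc Sw Ss T k x σ₁ σ₂ Φ hMc hSw hSs hS hdiff hσ₁ hσ₂ hΦ hT0 hTnn hT
  -- the trivial case `k = 0`
  rcases Nat.eq_zero_or_pos k with rfl | hk
  · simp only [Finset.range_zero, Finset.sum_empty, mul_zero, add_zero,
      Finset.Ico_eq_empty (by norm_num : ¬ (1:ℕ) < 0)] at hSw hSs
    rw [hSw, hSs]
    simp only [abs_zero, zero_div, add_zero, Finset.range_zero, Finset.sum_empty, mul_zero]
    have : 0 ≤ PowerSeries.coeff 0 (PowerSeries.mk T ^ 2) := by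
      rw [coeff_zero_mk_pow, hT0]; norm_num
    have hσ₁' : 0 ≤ σ₁ := (abs_nonneg _).trans hσ₁
    have hσ₂' : 0 ≤ σ₂ := (abs_nonneg _).trans hσ₂
    positivity
  -- notation at the point `x`
  set S : ℝ := sc 0 x with hSdef
  set S' : ℝ := deriv (sc 0) x with hS'def
  have hS0 : S ≠ 0 := hS.ne'
  have hσ₁' : 0 ≤ σ₁ := (abs_nonneg _).trans hσ₁
  have hσ₂' : 0 ≤ σ₂ := (abs_nonneg _).trans hσ₂
  have hΦ0 : 0 ≤ Real.exp (3 * x) * S ^ 3 := by positivity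
  have hΦ' : 0 ≤ Φ := hΦ0.trans hΦ
  set v : ℕ → ℝ := fun i => sc i x / S with hvdef
  set v' : ℕ → ℝ := fun i => deriv (fun y => sc i y / sc 0 y) x with hv'def
  set U : ℕ → ℝ := fun n => if n = 0 then 1 else T n with hUdef
  have hU0 : U 0 = 1 := by simp [hUdef]
  have hUpos : ∀ n, 1 ≤ n → U n = T n := fun n hn => by simp [hUdef, show n ≠ 0 by omega]
  have hUnn : ∀ n, 0 ≤ U n := fun n => by
    rcases Nat.eq_zero_or_pos n with rfl | hn
    · rw [hU0]; norm_num
    · rw [hUpos n hn]; exact hTnn n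
  have eU : (1 + PowerSeries.mk T : PowerSeries ℝ) = PowerSeries.mk U := one_add_mk_eq hT0
  -- values and derivatives of the `s`-coefficients through `v`, `v'`
  have hv0 : v 0 = 1 := by
    show sc 0 x / S = 1
    rw [← hSdef]; exact div_self hS0
  have hsc : ∀ i, sc i x = S * v i := fun i => by simp only [hvdef]; field_simp
  have hdsc : ∀ i, i < k → deriv (sc i) x = S * v' i + S' * v i := by
    intro i hi
    have hd : deriv (fun y => sc i y / sc 0 y) x =
        (deriv (sc i) x * sc 0 x - sc i x * deriv (sc 0) x) / sc 0 x ^ 2 :=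
      ((hdiff i hi).hasDerivAt.div (hdiff 0 hk).hasDerivAt hS0).deriv
    rw [← hSdef, ← hS'def] at hd
    simp only [hv'def, hvdef]
    rw [hd]
    field_simp
    ring
  -- the bounds on the lower orders
  have hbw : ∀ i, 1 ≤ i → i < k → |wc i x| ≤ T i := fun i h1 h2 => by
    have := hT i h1 h2
    have h3 : 0 ≤ |sc i x| / sc 0 x := by positivity
    nlinarith [abs_nonneg (deriv (wc i) x), abs_nonneg (deriv (fun y => sc i y / sc 0 y) x), sq_nonneg (sc 0 x)]
  have hbw' : ∀ i, 1 ≤ i → i < k → |deriv (wc i) x| ≤ T i := fun i h1 h2 => by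
    have := hT i h1 h2
    have h3 : 0 ≤ |sc i x| / sc 0 x := by positivity
    nlinarith [abs_nonneg (wc i x), abs_nonneg (deriv (fun y => sc i y / sc 0 y) x), sq_nonneg (sc 0 x)]
  have hbv : ∀ i, 1 ≤ i → i < k → |v i| ≤ T i := fun i h1 h2 => by
    have := hT i h1 h2
    have e : |v i| = |sc i x| / sc 0 x := by rw [hvdef]; simp only; rw [abs_div, abs_of_pos hS]
    rw [e]
    nlinarith [abs_nonneg (wc i x), abs_nonneg (deriv (wc i) x), abs_nonneg (deriv (fun y => sc i y / sc 0 y) x),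
      sq_nonneg (sc 0 x)]
  have hbv' : ∀ i, 1 ≤ i → i < k → |v' i| ≤ T i ∧ |S ^ 2 * v' i| ≤ T i := fun i h1 h2 => by
    have := hT i h1 h2
    have h3 : 0 ≤ |sc i x| / sc 0 x := by positivity
    have h4 : |S ^ 2 * v' i| = S ^ 2 * |v' i| := by rw [abs_mul, abs_of_nonneg (sq_nonneg S)]
    simp only [hv'def] at h4 ⊢
    rw [h4]
    constructor <;> nlinarith [abs_nonneg (wc i x), abs_nonneg (deriv (wc i) x),
      abs_nonneg (deriv (fun y => sc i y / sc 0 y) x), sq_nonneg (sc 0 x)]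
  have hvU : ∀ i, i < k → |v i| ≤ U i := fun i hi => by
    rcases Nat.eq_zero_or_pos i with rfl | h1
    · rw [hv0, hU0, abs_one]
    · rw [hUpos i h1]; exact hbv i h1 hi
  -- THE PRESSURE MONOMIALS: `|sc i (sc j′ + sc j)| ≤ (1 + σ₂) U_i U_j`
  have hP : ∀ i j, i < k → j < k → |sc i x * (deriv (sc j) x + sc j x)| ≤ (1 + σ₂) * U i * U j := by
    intro i j hi hj
    have hσ₂S : |S * (S' + S)| ≤ σ₂ := hσ₂
    rcases Nat.eq_zero_or_pos j with rfl | hj1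
    · -- `j = 0`: the factor is `S(S′ + S)`
      have e : sc i x * (deriv (sc 0) x + sc 0 x) = v i * (S * (S' + S)) := by rw [hsc i]; ring
      rw [e, abs_mul, hU0, mul_one]
      calc |v i| * |S * (S' + S)| ≤ U i * σ₂ := mul_le_mul (hvU i hi) hσ₂S (abs_nonneg _) (hUnn i)
        _ ≤ (1 + σ₂) * U i := by nlinarith [hUnn i]
    · -- `j ≥ 1`: `S² v_i v_j′ + S(S′+S) v_i v_j`
      have e : sc i x * (deriv (sc j) x + sc j x) = v i * (S ^ 2 * v' j) + v i * v j * (S * (S' + S)) := by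
        rw [hsc i, hdsc j hj, hsc j]; ring
      rw [e, hUpos j hj1]
      obtain ⟨-, h2⟩ := hbv' j hj1 hj
      calc |v i * (S ^ 2 * v' j) + v i * v j * (S * (S' + S))|
          ≤ |v i * (S ^ 2 * v' j)| + |v i * v j * (S * (S' + S))| := abs_add_le _ _
        _ = |v i| * |S ^ 2 * v' j| + |v i| * |v j| * |S * (S' + S)| := by
            rw [abs_mul (v i) (S ^ 2 * v' j), abs_mul (v i * v j), abs_mul (v i) (v j)]
        _ ≤ U i * T j + U i * T j * σ₂ := by
            gcongr
            · exact hUnn i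
            · exact hvU i hi
            · exact mul_nonneg (hUnn i) (hTnn j)
            · exact hUnn i
            · exact hvU i hi
            · exact hbv j hj1 hj
        _ = (1 + σ₂) * U i * T j := by ring
  -- the inner sums
  have hinner : ∀ p, p < k → |∑ i ∈ range (p + 1), sc i x * (deriv (sc (p - i)) x + sc (p - i) x)| ≤
      (1 + σ₂) * coeff p ((PowerSeries.mk U) ^ 2) := fun p hp =>
    inner_sum_le (F := fun i j => sc i x * (deriv (sc j) x + sc j x)) fun i hi => hP i (p - i) (by omega) (by omega)
  -- the stiffening coefficients
  have hMcb : ∀ c, 1 ≤ c → c ≤ k → |Mc c x| ≤ ∑ j ∈ range (c + 1), |m j| * Φ ^ j *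
      coeff (c - j) ((PowerSeries.mk U) ^ (3 * j)) := by
    intro c hc1 hck
    rw [hMc c]
    refine (abs_sum_le_sum_abs _ _).trans (sum_le_sum fun j hj => ?_)
    have hjc : j ≤ c := Nat.lt_succ_iff.mp (mem_range.mp hj)
    have emk : (PowerSeries.mk fun n => sc n x) = PowerSeries.mk fun n => S * v n := by
      ext n; simp [coeff_mk, hsc n]
    have e1 : |m j * Real.exp (3 * x) ^ j * coeff (c - j) ((PowerSeries.mk fun n => sc n x) ^ (3 * j))| =
        |m j| * (Real.exp (3 * x) * S ^ 3) ^ j * |coeff (c - j) ((PowerSeries.mk v) ^ (3 * j))| := by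
      rw [emk, coeff_mk_const_mul_pow, abs_mul, abs_mul, abs_mul, abs_of_nonneg (pow_nonneg (Real.exp_pos _).le j),
        abs_of_nonneg (pow_nonneg hS.le _), pow_mul, mul_pow]
      ring
    rw [e1]
    have h1 : (Real.exp (3 * x) * S ^ 3) ^ j ≤ Φ ^ j := pow_le_pow_left₀ hΦ0 hΦ j
    have h2 : |coeff (c - j) ((PowerSeries.mk v) ^ (3 * j))| ≤ coeff (c - j) ((PowerSeries.mk U) ^ (3 * j)) := by
      rcases Nat.eq_zero_or_pos j with rfl | hj1
      · simp only [mul_zero, pow_zero, coeff_one]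
        split_ifs <;> simp
      · refine (abs_coeff_mk_pow_le v (3 * j) (c - j)).trans ?_
        have hmono := coeff_pow_mono (t := fun n => |v n|) (c := U) (j := c - j)
          (fun n hn => ⟨abs_nonneg _, hvU n (by omega)⟩) (3 * j) (c - j) le_rfl
        exact hmono.2
    have h3 : 0 ≤ coeff (c - j) ((PowerSeries.mk U) ^ (3 * j)) :=
      (coeff_pow_mono (t := U) (c := U) (j := c - j) (fun n _ => ⟨hUnn n, le_rfl⟩) (3 * j) (c - j) le_rfl).1
    have h4 : 0 ≤ |m j| := abs_nonneg _
    exact mul_le_mul (mul_le_mul_of_nonneg_left h1 h4) h2 (abs_nonneg _) (mul_nonneg h4 (pow_nonneg hΦ' _))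
  -- the quadratic sums are dominated by `[Gᵏ] T²`
  have hquad : ∑ i ∈ Ico 1 k, T i * T (k - i) ≤ coeff k ((PowerSeries.mk T) ^ 2) := by
    rw [coeff_mk_sq]
    refine sum_le_sum_of_subset_of_nonneg (fun i hi => ?_) fun i _ _ => mul_nonneg (hTnn _) (hTnn _)
    rw [mem_Ico] at hi; rw [mem_range]; omega
  have hquad0 : 0 ≤ coeff k ((PowerSeries.mk T) ^ 2) :=
    (sum_nonneg fun i _ => mul_nonneg (hTnn i) (hTnn (k - i))).trans hquad
  -- the `w`-source
  have hW : |Sw x| ≤ (5 + 3 * σ₂) * coeff k ((PowerSeries.mk T) ^ 2) + 3 * (1 + σ₂) * ∑ p ∈ range k,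
      coeff p ((PowerSeries.mk U) ^ 2) * ∑ j ∈ range (k - p + 1), |m j| * Φ ^ j *
        coeff (k - p - j) ((PowerSeries.mk U) ^ (3 * j)) := by
    rw [hSw]
    refine (abs_add_le _ _).trans (add_le_add ?_ ?_)
    · refine (abs_sum_le_sum_abs _ _).trans ?_
      calc ∑ i ∈ Ico 1 k, |wc i x * deriv (wc (k - i)) x + wc i x * wc (k - i) x +
              3 * (sc i x * (deriv (sc (k - i)) x + sc (k - i) x))|
          ≤ ∑ i ∈ Ico 1 k, (5 + 3 * σ₂) * (T i * T (k - i)) := by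
            refine sum_le_sum fun i hi => ?_
            obtain ⟨hi1, hik⟩ := mem_Ico.mp hi
            have hki1 : 1 ≤ k - i := by omega
            have hkik : k - i < k := by omega
            have h1 : |wc i x * deriv (wc (k - i)) x| ≤ T i * T (k - i) := by
              rw [abs_mul]; exact mul_le_mul (hbw i hi1 hik) (hbw' _ hki1 hkik) (abs_nonneg _) (hTnn _)
            have h2 : |wc i x * wc (k - i) x| ≤ T i * T (k - i) := by
              rw [abs_mul]; exact mul_le_mul (hbw i hi1 hik) (hbw _ hki1 hkik) (abs_nonneg _) (hTnn _)
            have h3 : |3 * (sc i x * (deriv (sc (k - i)) x + sc (k - i) x))| ≤ 3 * ((1 + σ₂) * T i * T (k - i)) := by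
              rw [abs_mul, abs_of_pos (by norm_num : (0:ℝ) < 3)]
              have := hP i (k - i) hik hkik
              rw [hUpos i hi1, hUpos (k - i) hki1] at this
              linarith
            calc _ ≤ |wc i x * deriv (wc (k - i)) x + wc i x * wc (k - i) x| +
                  |3 * (sc i x * (deriv (sc (k - i)) x + sc (k - i) x))| := abs_add_le _ _
              _ ≤ (|wc i x * deriv (wc (k - i)) x| + |wc i x * wc (k - i) x|) +
                  |3 * (sc i x * (deriv (sc (k - i)) x + sc (k - i) x))| := by gcongr; exact abs_add_le _ _
              _ ≤ (T i * T (k - i) + T i * T (k - i)) + 3 * ((1 + σ₂) * T i * T (k - i)) := by gcongr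
              _ = (5 + 3 * σ₂) * (T i * T (k - i)) := by ring
        _ = (5 + 3 * σ₂) * ∑ i ∈ Ico 1 k, T i * T (k - i) := by rw [mul_sum]
        _ ≤ (5 + 3 * σ₂) * coeff k ((PowerSeries.mk T) ^ 2) := mul_le_mul_of_nonneg_left hquad (by linarith)
    · rw [abs_mul, abs_of_pos (by norm_num : (0:ℝ) < 3), mul_assoc, mul_sum]
      refine mul_le_mul_of_nonneg_left ((abs_sum_le_sum_abs _ _).trans (sum_le_sum fun p hp => ?_)) (by norm_num)
      have hp' : p < k := mem_range.mp hp
      rw [abs_mul]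
      have h1 := hinner p hp'
      have h2 := hMcb (k - p) (by omega) (by omega)
      have h3 : 0 ≤ ∑ j ∈ range (k - p + 1), |m j| * Φ ^ j * coeff (k - p - j) ((PowerSeries.mk U) ^ (3 * j)) :=
        sum_nonneg fun j _ => mul_nonneg (mul_nonneg (abs_nonneg _) (pow_nonneg hΦ' _))
          (coeff_pow_mono (t := U) (c := U) (j := k - p - j) (fun n _ => ⟨hUnn n, le_rfl⟩) (3 * j) _ le_rfl).1
      calc |∑ i ∈ range (p + 1), sc i x * (deriv (sc (p - i)) x + sc (p - i) x)| * |Mc (k - p) x|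
          ≤ ((1 + σ₂) * coeff p ((PowerSeries.mk U) ^ 2)) *
              ∑ j ∈ range (k - p + 1), |m j| * Φ ^ j * coeff (k - p - j) ((PowerSeries.mk U) ^ (3 * j)) :=
            mul_le_mul h1 h2 (abs_nonneg _) (by
              have : 0 ≤ coeff p ((PowerSeries.mk U) ^ 2) :=
                (coeff_pow_mono (t := U) (c := U) (j := p) (fun n _ => ⟨hUnn n, le_rfl⟩) 2 p le_rfl).1
              positivity)
        _ = (1 + σ₂) * (coeff p ((PowerSeries.mk U) ^ 2) *
              ∑ j ∈ range (k - p + 1), |m j| * Φ ^ j * coeff (k - p - j) ((PowerSeries.mk U) ^ (3 * j))) := by ring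
  -- the `s`-source over `S`
  have hSb : |Ss x| / sc 0 x ≤ (4 + σ₁) * coeff k ((PowerSeries.mk T) ^ 2) := by
    rw [← hSdef, ← abs_of_pos hS, ← abs_div, hSs, sum_div]
    refine (abs_sum_le_sum_abs _ _).trans ?_
    calc ∑ i ∈ Ico 1 k, |(wc i x * deriv (sc (k - i)) x + sc i x / 3 * deriv (wc (k - i)) x +
            2 * (sc i x * wc (k - i) x)) / S|
        ≤ ∑ i ∈ Ico 1 k, (4 + σ₁) * (T i * T (k - i)) := by
          refine sum_le_sum fun i hi => ?_
          obtain ⟨hi1, hik⟩ := mem_Ico.mp hi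
          have hki1 : 1 ≤ k - i := by omega
          have hkik : k - i < k := by omega
          have e : (wc i x * deriv (sc (k - i)) x + sc i x / 3 * deriv (wc (k - i)) x + 2 * (sc i x * wc (k - i) x)) / S
              = wc i x * v' (k - i) + wc i x * (S' / S) * v (k - i) + 1 / 3 * (v i * deriv (wc (k - i)) x) +
                2 * (v i * wc (k - i) x) := by
            rw [hdsc (k - i) hkik, hsc i]; field_simp
          rw [e]
          have hσ : |S' / S| ≤ σ₁ := hσ₁
          have h1 : |wc i x * v' (k - i)| ≤ T i * T (k - i) := by
            rw [abs_mul]; exact mul_le_mul (hbw i hi1 hik) (hbv' _ hki1 hkik).1 (abs_nonneg _) (hTnn _)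
          have h2 : |wc i x * (S' / S) * v (k - i)| ≤ T i * σ₁ * T (k - i) := by
            rw [abs_mul, abs_mul]
            exact mul_le_mul (mul_le_mul (hbw i hi1 hik) hσ (abs_nonneg _) (hTnn _)) (hbv _ hki1 hkik)
              (abs_nonneg _) (mul_nonneg (hTnn _) hσ₁')
          have h3 : |1 / 3 * (v i * deriv (wc (k - i)) x)| ≤ 1 / 3 * (T i * T (k - i)) := by
            rw [abs_mul, abs_of_pos (by norm_num : (0:ℝ) < 1 / 3), abs_mul]
            exact mul_le_mul_of_nonneg_left (mul_le_mul (hbv i hi1 hik) (hbw' _ hki1 hkik) (abs_nonneg _) (hTnn _))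
              (by norm_num)
          have h4 : |2 * (v i * wc (k - i) x)| ≤ 2 * (T i * T (k - i)) := by
            rw [abs_mul, abs_of_pos (by norm_num : (0:ℝ) < 2), abs_mul]
            exact mul_le_mul_of_nonneg_left (mul_le_mul (hbv i hi1 hik) (hbw _ hki1 hkik) (abs_nonneg _) (hTnn _))
              (by norm_num)
          have hTT : 0 ≤ T i * T (k - i) := mul_nonneg (hTnn _) (hTnn _)
          calc _ ≤ |wc i x * v' (k - i) + wc i x * (S' / S) * v (k - i) + 1 / 3 * (v i * deriv (wc (k - i)) x)| +
                |2 * (v i * wc (k - i) x)| := abs_add_le _ _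
            _ ≤ (|wc i x * v' (k - i) + wc i x * (S' / S) * v (k - i)| + |1 / 3 * (v i * deriv (wc (k - i)) x)|) +
                |2 * (v i * wc (k - i) x)| := by gcongr; exact abs_add_le _ _
            _ ≤ ((|wc i x * v' (k - i)| + |wc i x * (S' / S) * v (k - i)|) + |1 / 3 * (v i * deriv (wc (k - i)) x)|) +
                |2 * (v i * wc (k - i) x)| := by gcongr; exact abs_add_le _ _
            _ ≤ ((T i * T (k - i) + T i * σ₁ * T (k - i)) + 1 / 3 * (T i * T (k - i))) + 2 * (T i * T (k - i)) := by
                gcongr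
            _ ≤ (4 + σ₁) * (T i * T (k - i)) := by nlinarith
      _ = (4 + σ₁) * ∑ i ∈ Ico 1 k, T i * T (k - i) := by rw [mul_sum]
      _ ≤ (4 + σ₁) * coeff k ((PowerSeries.mk T) ^ 2) := mul_le_mul_of_nonneg_left hquad (by linarith)
  -- assemble
  rw [eU]
  have hsum0 : 0 ≤ ∑ p ∈ range k, coeff p ((PowerSeries.mk U) ^ 2) * ∑ j ∈ range (k - p + 1), |m j| * Φ ^ j *
      coeff (k - p - j) ((PowerSeries.mk U) ^ (3 * j)) :=
    sum_nonneg fun p _ => mul_nonneg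
      (coeff_pow_mono (t := U) (c := U) (j := p) (fun n _ => ⟨hUnn n, le_rfl⟩) 2 p le_rfl).1
      (sum_nonneg fun j _ => mul_nonneg (mul_nonneg (abs_nonneg _) (pow_nonneg hΦ' _))
        (coeff_pow_mono (t := U) (c := U) (j := k - p - j) (fun n _ => ⟨hUnn n, le_rfl⟩) (3 * j) _ le_rfl).1)
  linarith [hW, hSb]

end Summit.AtomisticToContinuum.HydrodynamicLimit.Theorems.PackingAnalyticImplosion

end
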